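import Mathlib
import Literature.Analysis.FluidPDE.OkamotoSakajoWunsch2008.SeparableBlowup

/-!
# OSW 2008 / separable blow-up: evaluation lemmas for exponentially decaying Fourier series

HONEST FRAMING (cell pub-oswblow): **1-D model (gCLM/OSW), computer-assisted; not Euler/NS.**

Companion to `SeparableBlowup.lean` (cell pub-oswblow, unit pub-oswblow-w2a; FRAME.md §11 item L1).  The typed
target `AnalyticSeparableProfile` speaks about a coefficient sequence `c : ℤ → ℂ` with `ExpDecay c ρ K` and the
pointwise series `fourierEval c`, `fourierEval (derivCoeff c)`, `fourierEval (hilbertCoeff c)`, `velocityEval c`.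
This file proves the elementary analysis that makes those series honest functions (no junk values) and
justifies the names: under `ExpDecay`,
* every series involved converges absolutely (`ExpDecay.summable_norm`, `…summable_term`), and `ExpDecay`
  is preserved by `hilbertCoeff` (same constants, `expDecay_hilbertCoeff`) and by `derivCoeff` (radius `ρ/2`,
  constant `2K/ρ`, `expDecay_derivCoeff`);
* `fourierEval c` is continuous and differentiable with derivative `fourierEval (derivCoeff c)`
  (termwise differentiation, `hasDerivAt_fourierEval`) — so `derivCoeff` really are the coefficients of `ω_x`;
* `velocityEval c` is differentiable with derivative `fourierEval (hilbertCoeff c)` (`hasDerivAt_velocityEval`) —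
  the relation `v_x = Hω` of [OkamotoSakajoWunsch2008, eq. (3)] holds for the typed objects;
* odd sequences give odd functions, real sequences (`c_{−k} = conj c_k`) give real values
  (`fourierEval_neg_of_isOddSeq`, `conj_fourierEval_of_isRealSeq`, `fourierEval_im_of_isRealSeq`), so the `.re`
  in `IsClassicalSolution` / `AnalyticSeparableProfile` loses nothing.
All statements are folklore (Weierstrass M-test; Mathlib's `hasDerivAt_tsum`).

References: H. Okamoto, T. Sakajo, M. Wunsch, Nonlinearity 21 (2008) 2447–2461 [OkamotoSakajoWunsch2008], eq. (3), §1.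
-/

noncomputable section

open Complex Filter Set
open scoped Topology

namespace Literature.Analysis.FluidPDE.OkamotoSakajoWunsch2008

/-! ### The characters -/

/-- `e^{ikx} = exp((k x) i)` with a real phase. [folklore] -/
theorem expChar_eq (k : ℤ) (x : ℝ) : expChar k x = Complex.exp ((((k : ℝ) * x : ℝ) : ℂ) * Complex.I) := by
  unfold expChar
  congr 1
  push_cast
  ring

/-- `|e^{ikx}| = 1`. [folklore] -/
theorem norm_expChar (k : ℤ) (x : ℝ) : ‖expChar k x‖ = 1 := by
  rw [expChar_eq]
  exact Complex.norm_exp_ofReal_mul_I _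

/-- `expChar k` is continuous in `x`. [folklore] -/
theorem continuous_expChar (k : ℤ) : Continuous (expChar k) := by
  unfold expChar
  fun_prop

/-- `d/dx e^{ikx} = ik e^{ikx}`. [folklore] -/
theorem hasDerivAt_expChar (k : ℤ) (x : ℝ) :
    HasDerivAt (expChar k) (Complex.I * (k : ℂ) * expChar k x) x := by
  have h1 : HasDerivAt (fun y : ℂ => Complex.exp (Complex.I * (k : ℂ) * y))
      (Complex.exp (Complex.I * (k : ℂ) * (x : ℂ)) * (Complex.I * (k : ℂ) * 1)) (x : ℂ) :=
    ((hasDerivAt_id (x : ℂ)).const_mul (Complex.I * (k : ℂ))).cexp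
  have h2 := h1.comp_ofReal
  have h3 : HasDerivAt (expChar k) (Complex.exp (Complex.I * (k : ℂ) * (x : ℂ)) * (Complex.I * (k : ℂ) * 1)) x :=
    h2.congr_of_eventuallyEq (Eventually.of_forall fun y => rfl)
  convert h3 using 1
  unfold expChar
  ring

/-! ### Exponential decay: summability and closure properties -/

/-- The constant of an `ExpDecay` bound is non-negative. [folklore] -/
theorem ExpDecay.nonneg {c : ℤ → ℂ} {ρ K : ℝ} (h : ExpDecay c ρ K) : 0 ≤ K := by
  have h0 := h.2 0
  simp only [Int.cast_zero, abs_zero, mul_zero, Real.exp_zero, mul_one] at h0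
  exact le_trans (norm_nonneg _) h0

/-- `Σ_{k ∈ ℤ} |k|^n e^{−ρ|k|} < ∞` for `ρ > 0`. [folklore] -/
theorem summable_pow_mul_exp_neg_abs (n : ℕ) {ρ : ℝ} (hρ : 0 < ρ) :
    Summable fun k : ℤ => |(k : ℝ)| ^ n * Real.exp (-ρ * |(k : ℝ)|) := by
  have hN := Real.summable_pow_mul_exp_neg_nat_mul n hρ
  refine Summable.of_nat_of_neg ?_ ?_
  · refine hN.congr fun m => ?_
    simp [Nat.abs_cast]
  · refine hN.congr fun m => ?_
    simp [Nat.abs_cast, abs_neg]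

/-- Under `ExpDecay`, the coefficients are absolutely summable. [folklore] -/
theorem ExpDecay.summable_norm {c : ℤ → ℂ} {ρ K : ℝ} (h : ExpDecay c ρ K) :
    Summable fun k : ℤ => ‖c k‖ := by
  have hS : Summable fun k : ℤ => K * Real.exp (-ρ * |(k : ℝ)|) := by
    have := (summable_pow_mul_exp_neg_abs 0 h.1).mul_left K
    simpa using this
  exact Summable.of_nonneg_of_le (fun k => norm_nonneg _) h.2 hS

/-- Under `ExpDecay`, `Σ |k| ‖c_k‖ < ∞` (the derivative series converges absolutely). [folklore] -/
theorem ExpDecay.summable_abs_mul_norm {c : ℤ → ℂ} {ρ K : ℝ} (h : ExpDecay c ρ K) :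
    Summable fun k : ℤ => |(k : ℝ)| * ‖c k‖ := by
  have hS : Summable fun k : ℤ => K * (|(k : ℝ)| ^ 1 * Real.exp (-ρ * |(k : ℝ)|)) :=
    (summable_pow_mul_exp_neg_abs 1 h.1).mul_left K
  refine Summable.of_nonneg_of_le (fun k => by positivity) (fun k => ?_) hS
  calc |(k : ℝ)| * ‖c k‖ ≤ |(k : ℝ)| * (K * Real.exp (-ρ * |(k : ℝ)|)) := by
        gcongr
        exact h.2 k
    _ = K * (|(k : ℝ)| ^ 1 * Real.exp (-ρ * |(k : ℝ)|)) := by ring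

/-- The terms of `fourierEval c x` are absolutely summable under `ExpDecay`. [folklore] -/
theorem ExpDecay.summable_term {c : ℤ → ℂ} {ρ K : ℝ} (h : ExpDecay c ρ K) (x : ℝ) :
    Summable fun k : ℤ => c k * expChar k x := by
  refine Summable.of_norm_bounded h.summable_norm fun k => ?_
  rw [norm_mul, norm_expChar, mul_one]

/-- `‖−i·sgn k‖ ≤ 1`. [folklore] -/
theorem norm_hilbertSymbol_le (k : ℤ) : ‖hilbertSymbol k‖ ≤ 1 := by
  unfold hilbertSymbol
  rcases lt_trichotomy k 0 with hk | hk | hk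
  · rw [Int.sign_eq_neg_one_of_neg hk]; simp
  · rw [hk]; simp
  · rw [Int.sign_eq_one_of_pos hk]; simp

/-- `ExpDecay` is preserved by the Hilbert transform (same constants). [folklore] -/
theorem expDecay_hilbertCoeff {c : ℤ → ℂ} {ρ K : ℝ} (h : ExpDecay c ρ K) :
    ExpDecay (hilbertCoeff c) ρ K := by
  refine ⟨h.1, fun k => ?_⟩
  calc ‖hilbertCoeff c k‖ = ‖hilbertSymbol k‖ * ‖c k‖ := by rw [hilbertCoeff, norm_mul]
    _ ≤ 1 * ‖c k‖ := by gcongr; exact norm_hilbertSymbol_le k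
    _ = ‖c k‖ := one_mul _
    _ ≤ K * Real.exp (-ρ * |(k : ℝ)|) := h.2 k

/-- `|k| e^{−ρ|k|} ≤ (2/ρ) e^{−ρ|k|/2}` (from `1 + y ≤ e^y`). [folklore] -/
theorem abs_mul_exp_neg_le {ρ : ℝ} (hρ : 0 < ρ) (t : ℝ) :
    |t| * Real.exp (-ρ * |t|) ≤ 2 / ρ * Real.exp (-(ρ / 2) * |t|) := by
  have ht : 0 ≤ |t| := abs_nonneg t
  have h1 : ρ / 2 * |t| ≤ Real.exp (ρ / 2 * |t|) := by
    have := Real.add_one_le_exp (ρ / 2 * |t|)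
    linarith
  have h2 : |t| ≤ 2 / ρ * Real.exp (ρ / 2 * |t|) := by
    have hρ2 : 0 < ρ / 2 := by positivity
    calc |t| = 2 / ρ * (ρ / 2 * |t|) := by field_simp
      _ ≤ 2 / ρ * Real.exp (ρ / 2 * |t|) := by gcongr
  calc |t| * Real.exp (-ρ * |t|)
      ≤ 2 / ρ * Real.exp (ρ / 2 * |t|) * Real.exp (-ρ * |t|) := by gcongr
    _ = 2 / ρ * Real.exp (-(ρ / 2) * |t|) := by
        rw [mul_assoc, ← Real.exp_add]
        congr 2; ring

/-- `ExpDecay` is preserved by differentiation, with half the radius: `‖ik c_k‖ ≤ (2K/ρ) e^{−(ρ/2)|k|}`.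
[folklore] -/
theorem expDecay_derivCoeff {c : ℤ → ℂ} {ρ K : ℝ} (h : ExpDecay c ρ K) :
    ExpDecay (derivCoeff c) (ρ / 2) (2 * K / ρ) := by
  refine ⟨by linarith [h.1], fun k => ?_⟩
  have hK := h.nonneg
  calc ‖derivCoeff c k‖ = |(k : ℝ)| * ‖c k‖ := by
        rw [derivCoeff, norm_mul, norm_mul, Complex.norm_I, one_mul, Complex.norm_intCast]
    _ ≤ |(k : ℝ)| * (K * Real.exp (-ρ * |(k : ℝ)|)) := by gcongr; exact h.2 k
    _ = K * (|(k : ℝ)| * Real.exp (-ρ * |(k : ℝ)|)) := by ring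
    _ ≤ K * (2 / ρ * Real.exp (-(ρ / 2) * |(k : ℝ)|)) :=
        mul_le_mul_of_nonneg_left (abs_mul_exp_neg_le h.1 _) hK
    _ = 2 * K / ρ * Real.exp (-(ρ / 2) * |(k : ℝ)|) := by ring

/-! ### Continuity and termwise differentiation -/

/-- `x ↦ Σ c_k e^{ikx}` is continuous under `ExpDecay` (Weierstrass M-test). [folklore] -/
theorem continuous_fourierEval {c : ℤ → ℂ} {ρ K : ℝ} (h : ExpDecay c ρ K) :
    Continuous (fourierEval c) := by
  unfold fourierEval
  refine continuous_tsum (fun k => continuous_const.mul (continuous_expChar k)) h.summable_norm ?_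
  intro k x
  rw [norm_mul, norm_expChar, mul_one]

/-- **Termwise differentiation**: under `ExpDecay`, `d/dx Σ c_k e^{ikx} = Σ (ik c_k) e^{ikx}`, i.e.
`fourierEval c` has derivative `fourierEval (derivCoeff c)`. [folklore] -/
theorem hasDerivAt_fourierEval {c : ℤ → ℂ} {ρ K : ℝ} (h : ExpDecay c ρ K) (x : ℝ) :
    HasDerivAt (fourierEval c) (fourierEval (derivCoeff c) x) x := by
  have hderiv : ∀ (k : ℤ) (y : ℝ),
      HasDerivAt (fun z => c k * expChar k z) (derivCoeff c k * expChar k y) y := by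
    intro k y
    have := (hasDerivAt_expChar k y).const_mul (c k)
    refine this.congr_deriv ?_
    unfold derivCoeff
    ring
  have hbound : ∀ (k : ℤ) (y : ℝ), ‖derivCoeff c k * expChar k y‖ ≤ |(k : ℝ)| * ‖c k‖ := by
    intro k y
    rw [norm_mul, norm_expChar, mul_one, derivCoeff, norm_mul, norm_mul, Complex.norm_I, one_mul,
      Complex.norm_intCast]
  have hmain := hasDerivAt_tsum h.summable_abs_mul_norm hderiv hbound (h.summable_term 0) x
  unfold fourierEval
  exact hmain

/-- The terms of `velocityEval` and their derivatives: `d/dx [(−i sgn k) c_k e^{ikx}/(ik)] = (−i sgn k) c_k e^{ikx}`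
(for `k = 0` both sides vanish). [folklore] -/
theorem hasDerivAt_velocity_term (c : ℤ → ℂ) (k : ℤ) (y : ℝ) :
    HasDerivAt (fun z => hilbertCoeff c k * expChar k z / (Complex.I * (k : ℂ)))
      (hilbertCoeff c k * expChar k y) y := by
  rcases eq_or_ne k 0 with hk | hk
  · subst hk
    have h0 : hilbertCoeff c 0 = 0 := by simp [hilbertCoeff, hilbertSymbol]
    simp only [h0, zero_mul, zero_div]
    exact hasDerivAt_const y 0
  · have hne : Complex.I * (k : ℂ) ≠ 0 := mul_ne_zero Complex.I_ne_zero (by exact_mod_cast hk)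
    have := ((hasDerivAt_expChar k y).const_mul (hilbertCoeff c k)).div_const (Complex.I * (k : ℂ))
    refine this.congr_deriv ?_
    rw [mul_div_assoc, mul_div_cancel_left₀ _ hne]

/-- **`v_x = Hω`** for the typed objects: under `ExpDecay`, `velocityEval c` has derivative
`fourierEval (hilbertCoeff c)` [cite: OkamotoSakajoWunsch2008, eq. (3)]. -/
theorem hasDerivAt_velocityEval {c : ℤ → ℂ} {ρ K : ℝ} (h : ExpDecay c ρ K) (x : ℝ) :
    HasDerivAt (velocityEval c) (fourierEval (hilbertCoeff c) x) x := by
  have hbound : ∀ (k : ℤ) (y : ℝ), ‖hilbertCoeff c k * expChar k y‖ ≤ ‖c k‖ := by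
    intro k y
    rw [norm_mul, norm_expChar, mul_one, hilbertCoeff, norm_mul]
    calc ‖hilbertSymbol k‖ * ‖c k‖ ≤ 1 * ‖c k‖ := by gcongr; exact norm_hilbertSymbol_le k
      _ = ‖c k‖ := one_mul _
  have h0 : Summable fun k : ℤ => hilbertCoeff c k * expChar k 0 / (Complex.I * (k : ℂ)) := by
    refine Summable.of_norm_bounded h.summable_norm fun k => ?_
    rcases eq_or_ne k 0 with hk | hk
    · subst hk; simp
    · rw [norm_div]
      have hk1 : (1 : ℝ) ≤ ‖Complex.I * (k : ℂ)‖ := by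
        rw [norm_mul, Complex.norm_I, one_mul, Complex.norm_intCast]
        exact_mod_cast Int.one_le_abs hk
      calc ‖hilbertCoeff c k * expChar k 0‖ / ‖Complex.I * (k : ℂ)‖
          ≤ ‖hilbertCoeff c k * expChar k 0‖ / 1 := by
            gcongr
        _ ≤ ‖c k‖ := by rw [div_one]; exact hbound k 0
  have hmain := hasDerivAt_tsum h.summable_norm (hasDerivAt_velocity_term c) hbound h0 x
  unfold velocityEval fourierEval
  exact hmain

/-! ### Symmetries: odd and real coefficient sequences -/

/-- `e^{ik(−x)} = e^{i(−k)x}`. [folklore] -/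
theorem expChar_neg (k : ℤ) (x : ℝ) : expChar k (-x) = expChar (-k) x := by
  unfold expChar
  congr 1
  push_cast
  ring

/-- `conj e^{ikx} = e^{i(−k)x}`. [folklore] -/
theorem conj_expChar (k : ℤ) (x : ℝ) : (starRingEnd ℂ) (expChar k x) = expChar (-k) x := by
  unfold expChar
  rw [← Complex.exp_conj]
  congr 1
  simp only [map_mul, Complex.conj_I, map_intCast, Complex.conj_ofReal]
  push_cast
  ring

/-- Odd coefficient sequences give odd functions: `f(−x) = −f(x)` (no summability needed). [folklore] -/
theorem fourierEval_neg_of_isOddSeq {c : ℤ → ℂ} (hodd : IsOddSeq c) (x : ℝ) :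
    fourierEval c (-x) = -fourierEval c x := by
  unfold fourierEval
  calc ∑' k : ℤ, c k * expChar k (-x) = ∑' k : ℤ, c k * expChar (-k) x := by simp_rw [expChar_neg]
    _ = ∑' k : ℤ, c (-k) * expChar (-(-k)) x :=
        ((Equiv.neg ℤ).tsum_eq (fun k => c k * expChar (-k) x)).symm
    _ = ∑' k : ℤ, -(c k * expChar k x) := by
        congr 1; ext k; rw [hodd k, neg_neg, neg_mul]
    _ = -∑' k : ℤ, c k * expChar k x := tsum_neg

/-- Real coefficient sequences (`c_{−k} = conj c_k`) give real values: `conj f(x) = f(x)` (no summability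
needed). [folklore] -/
theorem conj_fourierEval_of_isRealSeq {c : ℤ → ℂ} (hre : IsRealSeq c) (x : ℝ) :
    (starRingEnd ℂ) (fourierEval c x) = fourierEval c x := by
  unfold fourierEval
  rw [Complex.conj_tsum]
  calc ∑' k : ℤ, (starRingEnd ℂ) (c k * expChar k x) = ∑' k : ℤ, c (-k) * expChar (-k) x := by
        congr 1; ext k; rw [map_mul, conj_expChar, ← hre k]
    _ = ∑' k : ℤ, c k * expChar k x := (Equiv.neg ℤ).tsum_eq (fun k => c k * expChar k x)

/-- … hence `Im f(x) = 0`: the `.re` in `IsClassicalSolution`/`AnalyticSeparableProfile` loses nothing. [folklore] -/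
theorem fourierEval_im_of_isRealSeq {c : ℤ → ℂ} (hre : IsRealSeq c) (x : ℝ) : (fourierEval c x).im = 0 :=
  Complex.conj_eq_iff_im.mp (conj_fourierEval_of_isRealSeq hre x)

/-- `ω` real ⇒ `ω_x` real on the coefficient side. [folklore] -/
theorem isRealSeq_derivCoeff {c : ℤ → ℂ} (hre : IsRealSeq c) : IsRealSeq (derivCoeff c) := by
  intro k
  simp only [derivCoeff, map_mul, Complex.conj_I, map_intCast, hre k]
  push_cast
  ring

/-- `ω` real ⇒ `Hω` real on the coefficient side. [folklore] -/
theorem isRealSeq_hilbertCoeff {c : ℤ → ℂ} (hre : IsRealSeq c) : IsRealSeq (hilbertCoeff c) := by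
  intro k
  simp only [hilbertCoeff, hilbertSymbol, map_mul, map_neg, Complex.conj_I, map_intCast, hre k,
    Int.sign_neg, Int.cast_neg, neg_neg]
  ring

/-- `ω` odd ⇒ `Hω` even on the coefficient side (`sgn` is odd). [folklore] -/
theorem hilbertCoeff_neg_of_isOddSeq {c : ℤ → ℂ} (hodd : IsOddSeq c) (k : ℤ) :
    hilbertCoeff c (-k) = hilbertCoeff c k := by
  simp only [hilbertCoeff, hilbertSymbol, hodd k, Int.sign_neg, Int.cast_neg]
  ring

end Literature.Analysis.FluidPDE.OkamotoSakajoWunsch2008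

end
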